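import Summits.KontsevichZagierPeriods.KontsevichZagierPeriods.Theses.FurushoPentagon
import Literature.NumberTheory.Transcendental.KZProductIdeal

/-!
# Sketch — crux ReducedPeriodRing (stmt-KontsevichZagierPeriods-3929), ideator 3, round 1

First-lemma signatures for the two crux idea cards
* `cartier-at-the-torsor-nilpotents-are-pi-torsion` (Card A)
* `tate-coefficient-regular-effective-monoid` (Card B)
All statements are over existing declarations; the algebraic skeletons are proved (they are the
composition steps a crux-plan skeleton would kernel-check); the content lives in the hypotheses.
-/

namespace Summit.KontsevichZagierPeriods.KontsevichZagierPeriods.Cruxes.ReducedPeriodRing.Sketch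

open Literature.NumberTheory.Transcendental

/-- Card A, the new intermediate statement: nilpotents of the formal period ring
`P = FormalRep ⧸ relations` are `[π]`-power torsion (left-nested products, as in `KZ.PiLocalKernel`). -/
def NilIsPiTorsion : Prop :=
  ∀ c : KZ.FormalRep, c * c ∈ KZ.relations →
    ∃ N : ℕ, (fun d => KZ.of KZ.piRep * d)^[N] c ∈ KZ.relations

/-- Card A, composition: `NilIsPiTorsion ∧ PiCancellation ⇒ ReducedPeriodRing` (pure algebra). -/
theorem reducedPeriodRing_of_nilIsPiTorsion_of_piCancellation
    (h1 : NilIsPiTorsion) (h2 : KZ.PiCancellation) :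
    Summit.KontsevichZagierPeriods.KontsevichZagierPeriods.Theses.FurushoPentagon.ReducedPeriodRing := by
  intro c hc
  obtain ⟨N, hN⟩ := h1 c hc
  induction N with
  | zero => simpa using hN
  | succ n ih =>
    apply ih
    rw [Function.iterate_succ_apply'] at hN
    exact h2 _ hN

/-- Card A, transfer skeleton (the LOCALISED torsor): an additive, multiplicative map `γ` from
`FormalRep` to a REDUCED commutative ring (target: the coordinate ring of the period torsor
`𝒫̃ = 𝒫̃⁺[(2πi)⁻¹]`, reduced by Cartier), killing the four move families, whose kernel is
`[π]`-torsion modulo relations (this is `δ ∘ γ = id` for a section `δ` plus the calibration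
`δ(2πi) = 2i[π]`), forces `NilIsPiTorsion`. -/
theorem nilIsPiTorsion_of_localisedTransfer {R : Type*} [CommRing R] [IsReduced R]
    (γ : KZ.FormalRep →+ R) (hrel : ∀ c ∈ KZ.relations, γ c = 0)
    (hmul : ∀ a b : KZ.FormalRep, γ (a * b) = γ a * γ b)
    (hker : ∀ c : KZ.FormalRep, γ c = 0 →
      ∃ N : ℕ, (fun d => KZ.of KZ.piRep * d)^[N] c ∈ KZ.relations) :
    NilIsPiTorsion := by
  intro c hc
  apply hker
  have h0 : γ c * γ c = 0 := by rw [← hmul]; exact hrel _ hc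
  exact IsReduced.eq_zero _ ⟨2, by rw [pow_two]; exact h0⟩

/-- Card B, transfer skeleton (the EFFECTIVE monoid): an injective-mod-relations multiplicative
transfer into a REDUCED ring (target: `𝒫̃⁺ ⊗ ℂ ≅ 𝒪(M^eff) ⊗ ℂ`, Nori's effective diagram algebra,
reduced as soon as the Tate coefficient `χ` is a non-zero-divisor) gives the crux outright. -/
theorem reducedPeriodRing_of_effectiveTransfer {R : Type*} [CommRing R] [IsReduced R]
    (γ : KZ.FormalRep →+ R) (hrel : ∀ c ∈ KZ.relations, γ c = 0)
    (hmul : ∀ a b : KZ.FormalRep, γ (a * b) = γ a * γ b)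
    (hker : ∀ c : KZ.FormalRep, γ c = 0 → c ∈ KZ.relations) :
    Summit.KontsevichZagierPeriods.KontsevichZagierPeriods.Theses.FurushoPentagon.ReducedPeriodRing := by
  intro c hc
  apply hker
  have h0 : γ c * γ c = 0 := by rw [← hmul]; exact hrel _ hc
  exact IsReduced.eq_zero _ ⟨2, by rw [pow_two]; exact h0⟩

/-- Card B, the same transfer with the Tate coefficient regular in the target gives
`KZ.PiCancellation` (item 0540) as well: both cruxes sit under ONE motivic statement. -/
theorem piCancellation_of_effectiveTransfer {R : Type*} [CommRing R]
    (γ : KZ.FormalRep →+ R) (hrel : ∀ c ∈ KZ.relations, γ c = 0)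
    (hmul : ∀ a b : KZ.FormalRep, γ (a * b) = γ a * γ b)
    (hker : ∀ c : KZ.FormalRep, γ c = 0 → c ∈ KZ.relations)
    (hχ : ∀ x : R, γ (KZ.of KZ.piRep) * x = 0 → x = 0) : KZ.PiCancellation := by
  intro c hc
  apply hker
  apply hχ
  rw [← hmul]
  exact hrel _ hc

/-- Card B, the commutative-algebra heart of "χ regular ⇒ M^eff reduced": a ring with a
non-zero-divisor `χ` whose localisation `A[χ⁻¹]` is reduced is reduced (here `A[χ⁻¹] = 𝒪(G_mot)`,
reduced by Cartier). -/
theorem isReduced_of_regular_of_isReduced_away {A : Type*} [CommRing A] (χ : A)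
    (hχ : χ ∈ nonZeroDivisors A) [IsReduced (Localization.Away χ)] : IsReduced A := by
  have hinj : Function.Injective (algebraMap A (Localization.Away χ)) :=
    IsLocalization.injective (Localization.Away χ)
      (Submonoid.powers_le.mpr hχ)
  exact isReduced_of_injective (algebraMap A (Localization.Away χ)) hinj

end Summit.KontsevichZagierPeriods.KontsevichZagierPeriods.Cruxes.ReducedPeriodRing.Sketch
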